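import Mathlib
import Summits.NavierStokesRegularity.NavierStokesRegularity.Statement
import Summits.NavierStokesRegularity.NavierStokesRegularity.Theses.EulerZoomLiouville
import Summits.NavierStokesRegularity.NavierStokesRegularity.Theorems.EulerZoomLiouvilleSereginZoomReduction
import Literature.Analysis.FluidPDE.ClassicalSuitable
import Literature.Analysis.FluidPDE.SuitableWeakRescaling
import Literature.Analysis.FluidPDE.NSViscosityRescaling
import Literature.Analysis.FluidPDE.ForwardDSSMollifiedSchemeEnergy
import Literature.Analysis.FluidPDE.WholeSpaceIBP
import HarnessLib

/-!
# ConservativeEngine (3/4) — THE VISCOUS BIRTHMARK of a classical flow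

NODE N30 «THE CONSERVATIVE ENGINE» (decomp-ns lens-6 g18; critic row 196, CLEARED 2026-08-30T16:11:31Z) — banking file; node header,
thesis and sources: `Theorems/EulerZoomLiouvilleConservativeEngineToolkit.lean` (1/4).  Def-free: every lens predicate is spelled by its
body (the texts of the child route's items); proofs verbatim from `HOME/decomp-ns-lens-6/ConservativeEngine.lean` (0 sorry, std axioms).

This file: §4 — a classical solution obeys the local energy EQUALITY (CKN (2.5) with `=`) on every open region of its domain for ANY
distributional pressure `q` of the pair (pressure swap in `𝒟'(Q)`: two momentum equations ⟹ `∇(π − q) = 0` on balls ⟹ the flux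
difference dies by `div u = 0`) and ANY weak gradient (a.e. swap) — `hasLocalEnergyEqualityOn_of_classical`; and on every cylinder
`Q((νT,x₀), r)`, `r² < νT`, for the viscosity-normalised maximal smooth solution — `hasLocalEnergyEqualityOn_of_maximal` (BM).
Independent of the toolkit files (imports only the tree).
-/

noncomputable section

set_option linter.dupNamespace false

open MeasureTheory TopologicalSpace Set Function Filter Topology Metric Module
open scoped NNReal ENNReal InnerProductSpace RealInnerProductSpace Laplacian

namespace Summit.NavierStokesRegularity.NavierStokesRegularity.Theorems.ConservativeEngine

open Literature.Analysis Literature.Analysis.FluidPDE Literature.Analysis.FunctionSpaces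
open Summit.NavierStokesRegularity.NavierStokesRegularity.Theses.EulerZoomLiouville
open Summit.NavierStokesRegularity.NavierStokesRegularity.Theorems.SereginZoomReduction

/-! ## §4  The viscous birthmark at the INPUT: a classical solution obeys the local energy EQUALITY

CKN (2.5) holds with EQUALITY for `C²` solutions (tree: `local_energy_eq_of_contDiffOn`).  The datum handed
to the zoom by the residual `Cov` is the maximal smooth solution seen through the normalisation
`v(s,y) = ν⁻¹u(s/ν,y)` (classical at viscosity `1` on `(0, νT) × ℝ³`, Tao's footnote-3 rescaling) together with
an ABSTRACT pressure `q` and weak gradient `G`; we transfer the classical equality to `(v, q, G)`: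
the weak gradient is the classical one a.e. (`HasWeakSpatialGradientOn.ae_eq`), and the abstract pressure
may replace the classical one in the flux term because both solve the momentum equation in `𝒟'(Q)` with the
same velocity — test it with `ψ = φ v` and use `div v = 0` (`∫_Q (q − π) v·∇φ = 0`). -/

section Input

/-- A locally integrable function times a continuous function vanishing off a compact `K ⊆ Q` is integrable
on `Q`. [folklore] -/
theorem integrableOn_mul_of_locallyIntegrableOn {Q : Opens (ℝ × (EuclideanSpace ℝ (Fin 3)))} {P g : ℝ × (EuclideanSpace ℝ (Fin 3)) → ℝ}
    {K : Set (ℝ × (EuclideanSpace ℝ (Fin 3)))} (hP : LocallyIntegrableOn P (Q : Set (ℝ × (EuclideanSpace ℝ (Fin 3)))) volume) (hK : IsCompact K)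
    (hKQ : K ⊆ (Q : Set (ℝ × (EuclideanSpace ℝ (Fin 3))))) (hg : Continuous g) (hg0 : ∀ z ∉ K, g z = 0) :
    IntegrableOn (fun z => P z * g z) (Q : Set (ℝ × (EuclideanSpace ℝ (Fin 3)))) volume := by
  have h1 : IntegrableOn (fun z => P z * g z) K volume :=
    (hP.integrableOn_compact_subset hKQ hK).mul_continuousOn hg.continuousOn hK
  exact h1.of_forall_sdiff_eq_zero Q.isOpen.measurableSet fun z hz => by rw [hg0 z hz.2, mul_zero]

/-- A function continuous on an open `O ⊇ K` and vanishing off the compact `K` is integrable on every set.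
[folklore] -/
theorem integrableOn_of_continuousOn_of_eq_zero {O K A : Set (ℝ × (EuclideanSpace ℝ (Fin 3)))} {g : ℝ × (EuclideanSpace ℝ (Fin 3)) → ℝ} (hO : IsOpen O)
    (hK : IsCompact K) (hKO : K ⊆ O) (hg : ContinuousOn g O) (hg0 : ∀ z ∉ K, g z = 0) :
    IntegrableOn g A volume :=
  ((continuous_of_continuousOn_of_eq_zero hO hK.isClosed hKO hg hg0).integrable_of_hasCompactSupport
    (HasCompactSupport.intro hK hg0)).integrableOn

/-- **Birthmark transfer.**  If `(v, π)` is a classical Navier–Stokes pair (viscosity `1`, no force) on the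
open time set `S`, `Q ⊆ S × ℝ³` is open, `(v, q)` solves the system in `𝒟'(Q)` with some other pressure `q`,
and `G` is a weak spatial gradient of `v` on `Q`, then `(v, q, G)` satisfies the local energy EQUALITY on
`Q`. [cite: CaffarelliKohnNirenberg1982, §2 (2.5) with equality for smooth solutions] -/
theorem hasLocalEnergyEqualityOn_of_classical {S : Set ℝ} (hS : IsOpen S)
    {v : ℝ → (EuclideanSpace ℝ (Fin 3)) → (EuclideanSpace ℝ (Fin 3))} {π q : ℝ → (EuclideanSpace ℝ (Fin 3)) → ℝ} (hcl : IsClassicalNSSolutionOn S 1 0 v π)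
    {Q : Opens (ℝ × (EuclideanSpace ℝ (Fin 3)))} (hQ : (Q : Set (ℝ × (EuclideanSpace ℝ (Fin 3)))) ⊆ S ×ˢ univ)
    {G : ℝ → (EuclideanSpace ℝ (Fin 3)) → (EuclideanSpace ℝ (Fin 3)) →L[ℝ] (EuclideanSpace ℝ (Fin 3))} (hdist : IsDistributionalNSSolutionOn Q 1 0 v q)
    (hG : HasWeakSpatialGradientOn Q v G) :
    (∀ φ : ℝ → (EuclideanSpace ℝ (Fin 3)) → ℝ, IsSpaceTimeTestOn Q φ →
      2 * 1 * ∫ t, ∫ x, frobeniusNormSq (G t x) * φ t x =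
        ∫ t, ∫ x, (‖v t x‖ ^ 2 * (timeDeriv φ t x + 1 * Δ (φ t) x) +
          (‖v t x‖ ^ 2 + 2 * q t x) * ⟪v t x, gradient (φ t) x⟫)) := by
  intro φ hφ
  -- ### regularity of the classical pair
  have hu2 : ContDiffOn ℝ 2 (uncurry v) (S ×ˢ univ) := hcl.smooth_velocity.of_le (by norm_cast)
  have hu1 : ContDiffOn ℝ 1 (uncurry v) (S ×ˢ univ) := hu2.of_le one_le_two
  have hp1 : ContDiffOn ℝ 1 (uncurry π) (S ×ˢ univ) := hcl.smooth_pressure.of_le (by norm_cast)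
  have cu : ContinuousOn (fun z : ℝ × (EuclideanSpace ℝ (Fin 3)) => v z.1 z.2) (S ×ˢ univ) := hu2.continuousOn
  have cp : ContinuousOn (fun z : ℝ × (EuclideanSpace ℝ (Fin 3)) => π z.1 z.2) (S ×ˢ univ) := hp1.continuousOn
  have hmom : ∀ t ∈ S, ∀ x, timeDeriv v t x + convect (v t) (v t) x =
      (1 : ℝ) • (Δ (v t)) x - gradient (π t) x + (0 : ℝ → (EuclideanSpace ℝ (Fin 3)) → (EuclideanSpace ℝ (Fin 3))) t x := by
    intro t ht x
    have h := hcl.momentum t ht x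
    have e : timeDerivWithin S v t x = timeDeriv v t x := by
      simp only [timeDerivWithin, timeDeriv]
      exact derivWithin_of_isOpen hS ht
    rwa [e] at h
  have hf : ContinuousOn (uncurry (0 : ℝ → (EuclideanSpace ℝ (Fin 3)) → (EuclideanSpace ℝ (Fin 3)))) (S ×ˢ univ) := continuousOn_const
  have hSo : IsOpen (S ×ˢ (univ : Set (EuclideanSpace ℝ (Fin 3)))) := hS.prod isOpen_univ
  -- ### supports
  set K : Set (ℝ × (EuclideanSpace ℝ (Fin 3))) := tsupport (uncurry φ) with hK_def
  have hK : IsCompact K := hφ.hasCompactSupport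
  have hKQ : K ⊆ (Q : Set (ℝ × (EuclideanSpace ℝ (Fin 3)))) := hφ.tsupport_subset
  have hKS : K ⊆ S ×ˢ univ := hKQ.trans hQ
  have hT0 : ∀ z ∉ K, timeDeriv φ z.1 z.2 = 0 := fun z hz => timeDeriv_eq_zero_off_tsupport hz
  have hΔ0 : ∀ z ∉ K, Δ (φ z.1) z.2 = 0 := fun z hz =>
    laplacian_eq_zero_of_notMem_tsupport (notMem_tsupport_slice_of_notMem hz)
  have hg0 : ∀ z ∉ K, gradient (φ z.1) z.2 = 0 := fun z hz =>
    gradient_eq_zero_of_notMem_tsupport (notMem_tsupport_slice_of_notMem hz)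
  have hφ0 : ∀ z ∉ K, φ z.1 z.2 = 0 := fun z hz =>
    (image_eq_zero_of_notMem_tsupport hz : uncurry φ z = 0)
  -- ### (D) the weak gradient is the classical one a.e. on `Q`
  have hD : ∫ t, ∫ x, frobeniusNormSq (G t x) * φ t x =
      ∫ t, ∫ x, frobeniusNormSq (fderiv ℝ (v t) x) * φ t x := by
    have hae := hG.ae_eq (hasWeakSpatialGradientOn_of_contDiffOn hS hQ hu1)
    refine integral_integral_congr_ae_prod ?_
    filter_upwards [(ae_restrict_iff' Q.isOpen.measurableSet).1 hae] with z hz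
    by_cases hzQ : z ∈ (Q : Set (ℝ × (EuclideanSpace ℝ (Fin 3))))
    · have e : G z.1 z.2 = fderiv ℝ (v z.1) z.2 := hz hzQ
      rw [e]
    · rw [hφ0 z fun h => hzQ (hKQ h), mul_zero, mul_zero]
  -- ### (C) the classical local energy EQUALITY (classical pressure `π`, classical gradient)
  have hC := local_energy_eq_of_contDiffOn hS hQ hu2 hp1 hf hmom hcl.divFree hφ
  have eC : ∫ t, ∫ x, (‖v t x‖ ^ 2 * (timeDeriv φ t x + 1 * Δ (φ t) x) +
      (‖v t x‖ ^ 2 + 2 * π t x) * ⟪v t x, gradient (φ t) x⟫ +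
      2 * ⟪(0 : ℝ → (EuclideanSpace ℝ (Fin 3)) → (EuclideanSpace ℝ (Fin 3))) t x, v t x⟫ * φ t x) =
      ∫ t, ∫ x, (‖v t x‖ ^ 2 * (timeDeriv φ t x + 1 * Δ (φ t) x) +
      (‖v t x‖ ^ 2 + 2 * π t x) * ⟪v t x, gradient (φ t) x⟫) := by
    refine integral_congr_ae (Eventually.of_forall fun t => ?_)
    refine integral_congr_ae (Eventually.of_forall fun x => ?_)
    simp only [Pi.zero_apply, inner_zero_left, mul_zero, zero_mul, add_zero]
  rw [eC] at hC
  -- ### (E) the pressure swap `∫_Q q v·∇φ = ∫_Q π v·∇φ`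
  have cwO : ContinuousOn (fun z : ℝ × (EuclideanSpace ℝ (Fin 3)) => ⟪v z.1 z.2, gradient (φ z.1) z.2⟫) (S ×ˢ univ) :=
    cu.inner hφ.continuous_slice_gradient.continuousOn
  have hw0 : ∀ z ∉ K, ⟪v z.1 z.2, gradient (φ z.1) z.2⟫ = 0 := fun z hz => by
    rw [hg0 z hz, inner_zero_right]
  have cw : Continuous fun z : ℝ × (EuclideanSpace ℝ (Fin 3)) => ⟪v z.1 z.2, gradient (φ z.1) z.2⟫ :=
    continuous_of_continuousOn_of_eq_zero hSo hK.isClosed hKS cwO hw0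
  have iqw : IntegrableOn (fun z : ℝ × (EuclideanSpace ℝ (Fin 3)) => q z.1 z.2 * ⟪v z.1 z.2, gradient (φ z.1) z.2⟫)
      (Q : Set (ℝ × (EuclideanSpace ℝ (Fin 3)))) volume :=
    integrableOn_mul_of_locallyIntegrableOn hdist.2.2.1 hK hKQ cw hw0
  have iπw : IntegrableOn (fun z : ℝ × (EuclideanSpace ℝ (Fin 3)) => π z.1 z.2 * ⟪v z.1 z.2, gradient (φ z.1) z.2⟫)
      (Q : Set (ℝ × (EuclideanSpace ℝ (Fin 3)))) volume :=
    integrableOn_mul_of_locallyIntegrableOn ((cp.mono hQ).locallyIntegrableOn Q.isOpen.measurableSet)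
      hK hKQ cw hw0
  have hswap : ∫ z in (Q : Set (ℝ × (EuclideanSpace ℝ (Fin 3)))), q z.1 z.2 * ⟪v z.1 z.2, gradient (φ z.1) z.2⟫ =
      ∫ z in (Q : Set (ℝ × (EuclideanSpace ℝ (Fin 3)))), π z.1 z.2 * ⟪v z.1 z.2, gradient (φ z.1) z.2⟫ := by
    -- the vector test field `ψ = φ v`
    have hψ : IsSpaceTimeTestOn Q fun t x => φ t x • v t x :=
      isSpaceTimeTestOn_smul_of_contDiffOn hSo hQ hφ hcl.smooth_velocity
    set ψ : ℝ → (EuclideanSpace ℝ (Fin 3)) → (EuclideanSpace ℝ (Fin 3)) := fun t x => φ t x • v t x with hψ_def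
    set Kψ : Set (ℝ × (EuclideanSpace ℝ (Fin 3))) := tsupport (uncurry ψ) with hKψ_def
    have hKψ : IsCompact Kψ := hψ.hasCompactSupport
    have hKψQ : Kψ ⊆ (Q : Set (ℝ × (EuclideanSpace ℝ (Fin 3)))) := hψ.tsupport_subset
    have hKψS : Kψ ⊆ S ×ˢ univ := hKψQ.trans hQ
    have hψ0 : ∀ z ∉ Kψ, ψ z.1 z.2 = 0 := fun z hz =>
      (image_eq_zero_of_notMem_tsupport hz : uncurry ψ z = 0)
    have hDψ0 : ∀ z ∉ Kψ, fderiv ℝ (ψ z.1) z.2 = 0 := fun z hz =>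
      fderiv_of_notMem_tsupport ℝ (notMem_tsupport_slice_of_notMem hz)
    have hΔψ0 : ∀ z ∉ Kψ, Δ (ψ z.1) z.2 = 0 := fun z hz =>
      laplacian_eq_zero_of_notMem_tsupport (notMem_tsupport_slice_of_notMem hz)
    have hdivψ0 : ∀ z ∉ Kψ, VectorCalculus.divergence (ψ z.1) z.2 = 0 := fun z hz =>
      divergence_eq_zero_of_notMem_tsupport (notMem_tsupport_slice_of_notMem hz)
    have hTψ0 : ∀ z ∉ Kψ, timeDeriv ψ z.1 z.2 = 0 := fun z hz => timeDeriv_eq_zero_off_tsupport hz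
    -- `div ψ = v·∇φ` on `Q` (as `div v = 0`)
    have hdiv : ∀ z ∈ (Q : Set (ℝ × (EuclideanSpace ℝ (Fin 3)))),
        VectorCalculus.divergence (ψ z.1) z.2 = ⟪v z.1 z.2, gradient (φ z.1) z.2⟫ := by
      intro z hz
      have ht : z.1 ∈ S := (hQ hz).1
      have hvd : DifferentiableAt ℝ (v z.1) z.2 :=
        ((contDiff_slice_of_contDiffOn hu1 ht).differentiable one_ne_zero) z.2
      have hφd : DifferentiableAt ℝ (φ z.1) z.2 :=
        ((hφ.contDiff_slice z.1).differentiable (by simp)) z.2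
      have e : ψ z.1 = fun y => φ z.1 y • v z.1 y := rfl
      rw [e, divergence_smul_apply hφd hvd, hcl.divFree z.1 ht z.2, mul_zero, zero_add]
    -- integrability of the pieces of the momentum pairings on `Q`
    have cA : ContinuousOn (fun z : ℝ × (EuclideanSpace ℝ (Fin 3)) => ⟪v z.1 z.2, timeDeriv ψ z.1 z.2⟫ +
        ⟪v z.1 z.2, convect (v z.1) (ψ z.1) z.2⟫ + 1 * ⟪v z.1 z.2, Δ (ψ z.1) z.2⟫) (S ×ˢ univ) := by
      have cT : Continuous fun z : ℝ × (EuclideanSpace ℝ (Fin 3)) => timeDeriv ψ z.1 z.2 := hψ.continuous_timeDeriv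
      exact ((cu.inner cT.continuousOn).add
        (cu.inner (hψ.continuous_fderiv_slice.continuousOn.clm_apply cu))).add
        (continuousOn_const.mul (cu.inner hψ.continuous_laplacian_slice.continuousOn))
    have hA0 : ∀ z ∉ Kψ, ⟪v z.1 z.2, timeDeriv ψ z.1 z.2⟫ +
        ⟪v z.1 z.2, convect (v z.1) (ψ z.1) z.2⟫ + 1 * ⟪v z.1 z.2, Δ (ψ z.1) z.2⟫ = 0 := fun z hz => by
      simp only [convect, hDψ0 z hz, hΔψ0 z hz, hTψ0 z hz]
      simp
    have iA : IntegrableOn (fun z : ℝ × (EuclideanSpace ℝ (Fin 3)) => ⟪v z.1 z.2, timeDeriv ψ z.1 z.2⟫ +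
        ⟪v z.1 z.2, convect (v z.1) (ψ z.1) z.2⟫ + 1 * ⟪v z.1 z.2, Δ (ψ z.1) z.2⟫)
        (Q : Set (ℝ × (EuclideanSpace ℝ (Fin 3)))) volume :=
      integrableOn_of_continuousOn_of_eq_zero hSo hKψ hKψS cA hA0
    have cd : Continuous fun z : ℝ × (EuclideanSpace ℝ (Fin 3)) => VectorCalculus.divergence (ψ z.1) z.2 :=
      hψ.continuous_divergence_slice
    have iqd : IntegrableOn (fun z : ℝ × (EuclideanSpace ℝ (Fin 3)) => q z.1 z.2 * VectorCalculus.divergence (ψ z.1) z.2)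
        (Q : Set (ℝ × (EuclideanSpace ℝ (Fin 3)))) volume :=
      integrableOn_mul_of_locallyIntegrableOn hdist.2.2.1 hKψ hKψQ cd hdivψ0
    have iπd : IntegrableOn (fun z : ℝ × (EuclideanSpace ℝ (Fin 3)) => π z.1 z.2 * VectorCalculus.divergence (ψ z.1) z.2)
        (Q : Set (ℝ × (EuclideanSpace ℝ (Fin 3)))) volume :=
      integrableOn_mul_of_locallyIntegrableOn ((cp.mono hQ).locallyIntegrableOn Q.isOpen.measurableSet)
        hKψ hKψQ cd hdivψ0
    have iAq : IntegrableOn (fun z : ℝ × (EuclideanSpace ℝ (Fin 3)) => ⟪v z.1 z.2, timeDeriv ψ z.1 z.2⟫ +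
        ⟪v z.1 z.2, convect (v z.1) (ψ z.1) z.2⟫ + 1 * ⟪v z.1 z.2, Δ (ψ z.1) z.2⟫ +
        q z.1 z.2 * VectorCalculus.divergence (ψ z.1) z.2) (Q : Set (ℝ × (EuclideanSpace ℝ (Fin 3)))) volume := iA.add iqd
    have iAπ : IntegrableOn (fun z : ℝ × (EuclideanSpace ℝ (Fin 3)) => ⟪v z.1 z.2, timeDeriv ψ z.1 z.2⟫ +
        ⟪v z.1 z.2, convect (v z.1) (ψ z.1) z.2⟫ + 1 * ⟪v z.1 z.2, Δ (ψ z.1) z.2⟫ +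
        π z.1 z.2 * VectorCalculus.divergence (ψ z.1) z.2) (Q : Set (ℝ × (EuclideanSpace ℝ (Fin 3)))) volume := iA.add iπd
    have iF : IntegrableOn (fun z : ℝ × (EuclideanSpace ℝ (Fin 3)) => ⟪(0 : ℝ → (EuclideanSpace ℝ (Fin 3)) → (EuclideanSpace ℝ (Fin 3))) z.1 z.2, ψ z.1 z.2⟫)
        (Q : Set (ℝ × (EuclideanSpace ℝ (Fin 3)))) volume := by
      simp only [Pi.zero_apply, inner_zero_left]
      exact integrableOn_zero
    -- the two momentum pairings against `ψ`
    have h1 := hdist.2.2.2.2 ψ hψ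
    have h2 := (isDistributionalNSSolutionOn_of_contDiffOn hS hQ hu2 hp1 hf hmom hcl.divFree).2.2.2.2 ψ hψ
    rw [integral_add iAq iF, integral_add iA iqd] at h1
    rw [integral_add iAπ iF, integral_add iA iπd] at h2
    have h3 : ∫ z in (Q : Set (ℝ × (EuclideanSpace ℝ (Fin 3)))), q z.1 z.2 * VectorCalculus.divergence (ψ z.1) z.2 =
        ∫ z in (Q : Set (ℝ × (EuclideanSpace ℝ (Fin 3)))), π z.1 z.2 * VectorCalculus.divergence (ψ z.1) z.2 := by linarith
    have e1 : ∫ z in (Q : Set (ℝ × (EuclideanSpace ℝ (Fin 3)))), q z.1 z.2 * VectorCalculus.divergence (ψ z.1) z.2 =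
        ∫ z in (Q : Set (ℝ × (EuclideanSpace ℝ (Fin 3)))), q z.1 z.2 * ⟪v z.1 z.2, gradient (φ z.1) z.2⟫ :=
      setIntegral_congr_fun Q.isOpen.measurableSet fun z hz => by simp only [hdiv z hz]
    have e2 : ∫ z in (Q : Set (ℝ × (EuclideanSpace ℝ (Fin 3)))), π z.1 z.2 * VectorCalculus.divergence (ψ z.1) z.2 =
        ∫ z in (Q : Set (ℝ × (EuclideanSpace ℝ (Fin 3)))), π z.1 z.2 * ⟪v z.1 z.2, gradient (φ z.1) z.2⟫ :=
      setIntegral_congr_fun Q.isOpen.measurableSet fun z hz => by simp only [hdiv z hz]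
    rw [e1, e2] at h3
    exact h3
  -- ### (F) assembling: both right-hand sides are integrals over `Q`, and they differ by the swap
  have cT : Continuous fun z : ℝ × (EuclideanSpace ℝ (Fin 3)) => timeDeriv φ z.1 z.2 := hφ.continuous_timeDeriv
  have cRπ : ContinuousOn (fun z : ℝ × (EuclideanSpace ℝ (Fin 3)) => ‖v z.1 z.2‖ ^ 2 * (timeDeriv φ z.1 z.2 + 1 * Δ (φ z.1) z.2) +
      (‖v z.1 z.2‖ ^ 2 + 2 * π z.1 z.2) * ⟪v z.1 z.2, gradient (φ z.1) z.2⟫) (S ×ˢ univ) :=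
    ((cu.norm.pow 2).mul (cT.continuousOn.add
      (continuousOn_const.mul hφ.continuous_laplacian_slice.continuousOn))).add
      (((cu.norm.pow 2).add (continuousOn_const.mul cp)).mul cwO)
  have hRπ0 : ∀ z ∉ K, ‖v z.1 z.2‖ ^ 2 * (timeDeriv φ z.1 z.2 + 1 * Δ (φ z.1) z.2) +
      (‖v z.1 z.2‖ ^ 2 + 2 * π z.1 z.2) * ⟪v z.1 z.2, gradient (φ z.1) z.2⟫ = 0 := fun z hz => by
    rw [hT0 z hz, hΔ0 z hz, hg0 z hz]
    simp only [inner_zero_right, mul_zero, add_zero]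
  have hRq0 : ∀ z, z ∉ (Q : Set (ℝ × (EuclideanSpace ℝ (Fin 3)))) → ‖v z.1 z.2‖ ^ 2 * (timeDeriv φ z.1 z.2 + 1 * Δ (φ z.1) z.2) +
      (‖v z.1 z.2‖ ^ 2 + 2 * q z.1 z.2) * ⟪v z.1 z.2, gradient (φ z.1) z.2⟫ = 0 := fun z hz => by
    have hz' : z ∉ K := fun h => hz (hKQ h)
    rw [hT0 z hz', hΔ0 z hz', hg0 z hz']
    simp only [inner_zero_right, mul_zero, add_zero]
  have iRπ : IntegrableOn (fun z : ℝ × (EuclideanSpace ℝ (Fin 3)) => ‖v z.1 z.2‖ ^ 2 * (timeDeriv φ z.1 z.2 + 1 * Δ (φ z.1) z.2) +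
      (‖v z.1 z.2‖ ^ 2 + 2 * π z.1 z.2) * ⟪v z.1 z.2, gradient (φ z.1) z.2⟫) (Q : Set (ℝ × (EuclideanSpace ℝ (Fin 3)))) volume :=
    integrableOn_of_continuousOn_of_eq_zero hSo hK hKS cRπ hRπ0
  have iM : IntegrableOn (fun z : ℝ × (EuclideanSpace ℝ (Fin 3)) => 2 * (q z.1 z.2 * ⟪v z.1 z.2, gradient (φ z.1) z.2⟫ -
      π z.1 z.2 * ⟪v z.1 z.2, gradient (φ z.1) z.2⟫)) (Q : Set (ℝ × (EuclideanSpace ℝ (Fin 3)))) volume :=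
    (iqw.sub iπw).const_mul 2
  have eRq : (fun z : ℝ × (EuclideanSpace ℝ (Fin 3)) => ‖v z.1 z.2‖ ^ 2 * (timeDeriv φ z.1 z.2 + 1 * Δ (φ z.1) z.2) +
      (‖v z.1 z.2‖ ^ 2 + 2 * q z.1 z.2) * ⟪v z.1 z.2, gradient (φ z.1) z.2⟫) =
      fun z => (‖v z.1 z.2‖ ^ 2 * (timeDeriv φ z.1 z.2 + 1 * Δ (φ z.1) z.2) +
        (‖v z.1 z.2‖ ^ 2 + 2 * π z.1 z.2) * ⟪v z.1 z.2, gradient (φ z.1) z.2⟫) +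
        2 * (q z.1 z.2 * ⟪v z.1 z.2, gradient (φ z.1) z.2⟫ -
          π z.1 z.2 * ⟪v z.1 z.2, gradient (φ z.1) z.2⟫) := by
    funext z
    ring
  have iRq : IntegrableOn (fun z : ℝ × (EuclideanSpace ℝ (Fin 3)) => ‖v z.1 z.2‖ ^ 2 * (timeDeriv φ z.1 z.2 + 1 * Δ (φ z.1) z.2) +
      (‖v z.1 z.2‖ ^ 2 + 2 * q z.1 z.2) * ⟪v z.1 z.2, gradient (φ z.1) z.2⟫) (Q : Set (ℝ × (EuclideanSpace ℝ (Fin 3)))) volume := by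
    rw [eRq]
    exact iRπ.add iM
  have hIπ : ∫ z in (Q : Set (ℝ × (EuclideanSpace ℝ (Fin 3)))), (‖v z.1 z.2‖ ^ 2 * (timeDeriv φ z.1 z.2 + 1 * Δ (φ z.1) z.2) +
      (‖v z.1 z.2‖ ^ 2 + 2 * π z.1 z.2) * ⟪v z.1 z.2, gradient (φ z.1) z.2⟫) =
      ∫ t, ∫ x, (‖v t x‖ ^ 2 * (timeDeriv φ t x + 1 * Δ (φ t) x) +
      (‖v t x‖ ^ 2 + 2 * π t x) * ⟪v t x, gradient (φ t) x⟫) :=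
    setIntegral_eq_integral_integral_of_continuousOn hS hK hKQ hQ cRπ hRπ0
  have hIq : ∫ t, ∫ x, (‖v t x‖ ^ 2 * (timeDeriv φ t x + 1 * Δ (φ t) x) +
      (‖v t x‖ ^ 2 + 2 * q t x) * ⟪v t x, gradient (φ t) x⟫) =
      ∫ z in (Q : Set (ℝ × (EuclideanSpace ℝ (Fin 3)))), (‖v z.1 z.2‖ ^ 2 * (timeDeriv φ z.1 z.2 + 1 * Δ (φ z.1) z.2) +
      (‖v z.1 z.2‖ ^ 2 + 2 * q z.1 z.2) * ⟪v z.1 z.2, gradient (φ z.1) z.2⟫) :=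
    integral_integral_eq_setIntegral iRq hRq0
  have hRR : ∫ z in (Q : Set (ℝ × (EuclideanSpace ℝ (Fin 3)))), (‖v z.1 z.2‖ ^ 2 * (timeDeriv φ z.1 z.2 + 1 * Δ (φ z.1) z.2) +
      (‖v z.1 z.2‖ ^ 2 + 2 * q z.1 z.2) * ⟪v z.1 z.2, gradient (φ z.1) z.2⟫) =
      ∫ z in (Q : Set (ℝ × (EuclideanSpace ℝ (Fin 3)))), (‖v z.1 z.2‖ ^ 2 * (timeDeriv φ z.1 z.2 + 1 * Δ (φ z.1) z.2) +
      (‖v z.1 z.2‖ ^ 2 + 2 * π z.1 z.2) * ⟪v z.1 z.2, gradient (φ z.1) z.2⟫) := by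
    rw [eRq, integral_add iRπ iM, integral_const_mul, integral_sub iqw iπw, hswap, sub_self, mul_zero,
      add_zero]
  rw [hD, hC, hIq, hRR, hIπ]

/-- **The route datum carries the birthmark.**  For a maximal smooth solution `(u, p)` on `[0, T)` at
viscosity `ν > 0`, the normalised velocity `v(s,y) = ν⁻¹u(s/ν,y)` satisfies, with ANY distributional pressure
`q` and ANY weak gradient `G` on a cylinder `Q((νT,x₀), r)` with `r² < νT` on which `(v, q)` is a suitable weak
pair, the local energy EQUALITY. [cite: Tao2011, footnote 3; CaffarelliKohnNirenberg1982, §2 (2.5)] -/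
theorem hasLocalEnergyEqualityOn_of_maximal {ν T : ℝ} (hν : 0 < ν) {u : ℝ → (EuclideanSpace ℝ (Fin 3)) → (EuclideanSpace ℝ (Fin 3))} {p : ℝ → (EuclideanSpace ℝ (Fin 3)) → ℝ}
    (hmax : IsMaximalSmoothSolution ν 0 u p T) {x₀ : (EuclideanSpace ℝ (Fin 3))} {q : ℝ → (EuclideanSpace ℝ (Fin 3)) → ℝ}
    {G : ℝ → (EuclideanSpace ℝ (Fin 3)) → (EuclideanSpace ℝ (Fin 3)) →L[ℝ] (EuclideanSpace ℝ (Fin 3))} {r : ℝ} (hrT : r ^ 2 < ν * T)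
    (hsw : IsSuitableWeakSolutionInBall r (ν * T, x₀) (fun s y => ν⁻¹ • u (s / ν) y) q)
    (hG : HasWeakSpatialGradientOn (parabolicCylinderOpens r (ν * T, x₀)) (fun s y => ν⁻¹ • u (s / ν) y) G) :
    (∀ φ : ℝ → (EuclideanSpace ℝ (Fin 3)) → ℝ, IsSpaceTimeTestOn (parabolicCylinderOpens r (ν * T, x₀)) φ →
      2 * 1 * ∫ t, ∫ x, frobeniusNormSq (G t x) * φ t x =
        ∫ t, ∫ x, (‖(fun s y => ν⁻¹ • u (s / ν) y) t x‖ ^ 2 * (timeDeriv φ t x + 1 * Δ (φ t) x) +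
          (‖(fun s y => ν⁻¹ • u (s / ν) y) t x‖ ^ 2 + 2 * q t x) * ⟪(fun s y => ν⁻¹ • u (s / ν) y) t x, gradient (φ t) x⟫)) := by
  have hveq : timeRescale ν⁻¹ ν⁻¹ u = fun s y => ν⁻¹ • u (s / ν) y := by
    funext s y
    rw [timeRescale_apply, div_eq_inv_mul]
  have hcl' : IsClassicalNSSolutionOn (Ioo 0 (ν * T)) 1 0 (fun s y => ν⁻¹ • u (s / ν) y)
      (timeRescale ν⁻¹ (ν⁻¹ ^ 2) p) := by
    have hmaps : MapsTo (fun τ => ν⁻¹ * τ) (Ioo 0 (ν * T)) (Ico 0 T) := by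
      intro τ hτ
      refine ⟨by have := hτ.1.le; positivity, ?_⟩
      rw [inv_mul_lt_iff₀ hν]
      exact hτ.2
    have h := hmax.1.viscosityRescale_set hν.ne' hmaps isOpen_Ioo.uniqueDiffOn
    rwa [timeRescale_zero_force, hveq] at h
  have hQ : ((parabolicCylinderOpens r (ν * T, x₀) : Opens (ℝ × (EuclideanSpace ℝ (Fin 3)))) : Set (ℝ × (EuclideanSpace ℝ (Fin 3)))) ⊆
      Ioo 0 (ν * T) ×ˢ univ := by
    intro z hz
    have hz' : z ∈ parabolicCylinder r (ν * T, x₀) := hz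
    simp only [parabolicCylinder, mem_prod, mem_Ioo, mem_ball] at hz'
    exact ⟨⟨by linarith [hz'.1.1], hz'.1.2⟩, mem_univ _⟩
  exact hasLocalEnergyEqualityOn_of_classical isOpen_Ioo hcl' hQ hsw.1.distributional hG

end Input

end Summit.NavierStokesRegularity.NavierStokesRegularity.Theorems.ConservativeEngine

end
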